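import Literature.NumberTheory.Automorphic.UnitaryGroupTruncatedKernelClassCuspVanishing
import Literature.NumberTheory.Automorphic.UnitaryGroupUnipotentHaarNormalisation
import Literature.NumberTheory.Automorphic.UnitaryGroupUnipotentCentreLatticeAssembly
import HarnessLib

/-!
# The Haar mass of a strict fundamental set of `N(F)` in `N(𝔸_F)` is positive and finite
(Rogawski, *Automorphic Representations of Unitary Groups in Three Variables* (1990), §2.1 (p. 11) and §7.3 (p. 96):
`N(F)∖N(𝔸_F)` is compact — «`m(N∖𝐍) = 1`» is a legitimate normalisation; Arthur, *A trace formula for reductive groups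
I*, Duke Math. J. 45 (1978), §1.)

Topic `NumberTheory/Automorphic`; namespace `Literature.NumberTheory.Automorphic.UnitaryGroup`. THEOREMS ONLY over
accepted tree modules (no definition, no named fact, no instance, no notation, no `sorry`). Row (S) «`μ_N(Ω) ∈ (0, ∞)`»
of the T1-qs LAW 5 road of `Cruxes/H413/Lines/F0_T1InnerFormTraceIdentity.lean` (cell `pub/hodgecm-mathlib`, crux H413;
desk F0P3a-p05 (g7) 2026-08-31T14:11Z): the factor `μ_N(Ω)` that ★ (C-G)
`exists_weight_torus_kAverage_of_unipotent_invariant` keeps visible — for a measurable STRICT fundamental set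
`Ω ⊆ unipotentInBorel F E c 3` of `N(F)_N` (every orbit meets `Ω` exactly once) and ANY Haar measure `μ_N` — is
positive and finite; hence the hypothesis `hΩfin : μ_N(Ω) ≠ ∞` of ★ (C-γ)
`lintegral_weight_mul_enorm_centrePart_lt_top_of_hasCompactSupport` ∕ `exists_integrable_and_integral_weight_smul_centrePart_eq`
is discharged (corollaries `…_cc`, «compact covolume»).

PROOF. Transport `μ_N` along the tautological isomorphism ★ `unipToBorelₜ : adelicUnipotent ≃ₜ* unipotentInBorel` to a
Haar measure `ν` of `N(𝔸_F) = adelicUnipotent F E c 3` (Mathlib `ContinuousMulEquiv.isHaarMeasure_map`); there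
`unipToBorel ⁻¹' Ω` is an a.e. fundamental domain of `N(F) = rationalUnipotent` (★ `isFundamentalDomain_preimage_unipToBorel`)
whose mass is that of the Heisenberg box, positive and finite (★ `measure_fundamentalDomain_ne_zero_and_lt_top`).

HC_CM is proved only modulo the 7 printed citations until rung 0 closes — nothing here bears on a summit statement.

## References
* J. D. Rogawski, *Automorphic Representations of Unitary Groups in Three Variables*, Ann. of Math. Stud. 123 (1990),
  §2.1 (p. 11), §7.3 (p. 96) [Rogawski1990].
* J. Arthur, *A trace formula for reductive groups I*, Duke Math. J. 45 (1978), §1 [Arthur1978TraceFormulaI].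
-/

set_option autoImplicit false

noncomputable section

open MeasureTheory MeasureTheory.Measure Set NumberField IsDedekindDomain
open Literature.MeasureTheory.Group
open Literature.NumberTheory.QuadraticForms (normIdeles)
open scoped ENNReal NNReal

namespace Literature.NumberTheory.Automorphic

namespace UnitaryGroup

variable {F E : Type} [Field F] [NumberField F] [Field E] [NumberField E] [Algebra F E]
  {c : E ≃ₐ[F] E}

variable [MeasurableSpace (quasiSplit F E c 3).Adelic] [BorelSpace (quasiSplit F E c 3).Adelic]

/-! ## §1 `0 < μ_N(Ω) < ∞` -/

/-- **THE HAAR MASS OF A STRICT FUNDAMENTAL SET OF `N(F)_N` IS POSITIVE AND FINITE.** For the quasi-split `U(J₃)`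
(`c² = 1`), any Haar measure `μ_N` of `N(𝔸_F) = unipotentInBorel F E c 3` and any measurable `Ω ⊆ N(𝔸_F)` meeting every
`N(F)_N`-orbit exactly once: `μ_N(Ω) ≠ 0` and `μ_N(Ω) < ∞` — `N(F)∖N(𝔸_F)` is compact of positive covolume
(«`m(N∖𝐍) = 1`»). [cite: Rogawski1990, §2.1 (p. 11)] [cite: Rogawski1990, §7.3 (p. 96)] [cite: Arthur1978TraceFormulaI, §1] -/
theorem measure_strictFundamentalSet_unipotent_ne_zero_and_lt_top (hc : c * c = 1)
    (μN : Measure (unipotentInBorel F E c 3)) [μN.IsHaarMeasure]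
    {Ω : Set (unipotentInBorel F E c 3)} (hΩ : MeasurableSet Ω)
    (hΩu : ∀ n : unipotentInBorel F E c 3,
      ∃! ν : (((quasiSplit F E c 3).arithmeticSubgroup).subgroupOf (borelAdelic F E c 3)).subgroupOf
        (unipotentInBorel F E c 3), ν • n ∈ Ω) :
    μN Ω ≠ 0 ∧ μN Ω < ⊤ := by
  -- structure
  haveI : LocallyCompactSpace (AdeleRing (𝓞 E) E) := locallyCompactSpace_adeleRing' E
  letI : MeasurableSpace (AdeleRing (𝓞 E) E) := borel _
  haveI : BorelSpace (AdeleRing (𝓞 E) E) := ⟨rfl⟩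
  haveI : BorelSpace (traceZeroAdele F E c) := Subtype.borelSpace _
  haveI : LocallyCompactSpace (traceZeroAdele F E c) := locallyCompactSpace_traceZeroAdele
  haveI : BorelSpace (borelAdelic F E c 3) := Subtype.borelSpace _
  haveI : BorelSpace (unipotentInBorel F E c 3) := Subtype.borelSpace _
  haveI : BorelSpace (adelicUnipotent F E c 3) := Subtype.borelSpace _
  -- transport `μ_N` to `adelicUnipotent` along `unipToBorelₜ`
  set ν : Measure (adelicUnipotent F E c 3) := μN.map (unipToBorelₜ F E c).symm with hν
  haveI : ν.IsHaarMeasure := (unipToBorelₜ F E c).symm.isHaarMeasure_map μN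
  have hpre : ((unipToBorelₜ F E c).symm : unipotentInBorel F E c 3 → adelicUnipotent F E c 3) ⁻¹'
      ((unipToBorel F E c) ⁻¹' Ω) = Ω := by
    ext n
    simp only [Set.mem_preimage]
    exact Iff.of_eq (congrArg (· ∈ Ω) ((unipToBorel F E c).apply_symm_apply n))
  have hΩ' : MeasurableSet ((unipToBorel F E c) ⁻¹' Ω) := hΩ.preimage continuous_unipToBorel.measurable
  have hmeas : Measurable ((unipToBorelₜ F E c).symm : unipotentInBorel F E c 3 → adelicUnipotent F E c 3) :=
    (unipToBorelₜ F E c).symm.continuous.measurable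
  have hνΩ : ν ((unipToBorel F E c) ⁻¹' Ω) = μN Ω := by
    rw [hν, Measure.map_apply hmeas hΩ', hpre]
  -- the transported set is an a.e. fundamental domain of `N(F)` of positive finite mass
  obtain ⟨h𝓕, -⟩ := isFundamentalDomain_preimage_unipToBorel hc ν hΩ hΩu
  have h := measure_fundamentalDomain_ne_zero_and_lt_top hc (Measure.addHaar : Measure (AdeleRing (𝓞 E) E))
    (Measure.addHaar : Measure (traceZeroAdele F E c)) ν h𝓕
  rwa [hνΩ] at h

/-- `μ_N(Ω) ≠ 0` for a measurable strict fundamental set `Ω` of `N(F)_N`. [cite: Rogawski1990, §2.1 (p. 11)] -/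
theorem measure_strictFundamentalSet_unipotent_ne_zero (hc : c * c = 1)
    (μN : Measure (unipotentInBorel F E c 3)) [μN.IsHaarMeasure]
    {Ω : Set (unipotentInBorel F E c 3)} (hΩ : MeasurableSet Ω)
    (hΩu : ∀ n : unipotentInBorel F E c 3,
      ∃! ν : (((quasiSplit F E c 3).arithmeticSubgroup).subgroupOf (borelAdelic F E c 3)).subgroupOf
        (unipotentInBorel F E c 3), ν • n ∈ Ω) :
    μN Ω ≠ 0 :=
  (measure_strictFundamentalSet_unipotent_ne_zero_and_lt_top hc μN hΩ hΩu).1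

/-- `μ_N(Ω) ≠ ∞` for a measurable strict fundamental set `Ω` of `N(F)_N` — the hypothesis `hΩfin` of ★ (C-γ).
[cite: Rogawski1990, §2.1 (p. 11)] -/
theorem measure_strictFundamentalSet_unipotent_ne_top (hc : c * c = 1)
    (μN : Measure (unipotentInBorel F E c 3)) [μN.IsHaarMeasure]
    {Ω : Set (unipotentInBorel F E c 3)} (hΩ : MeasurableSet Ω)
    (hΩu : ∀ n : unipotentInBorel F E c 3,
      ∃! ν : (((quasiSplit F E c 3).arithmeticSubgroup).subgroupOf (borelAdelic F E c 3)).subgroupOf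
        (unipotentInBorel F E c 3), ν • n ∈ Ω) :
    μN Ω ≠ ⊤ :=
  (measure_strictFundamentalSet_unipotent_ne_zero_and_lt_top hc μN hΩ hΩu).2.ne

/-- `0 < μ_N.real(Ω)` for a measurable strict fundamental set `Ω` of `N(F)_N` (so the factor `μ_N.real Ω` of ★ (C-G) (B)
is invertible). [cite: Rogawski1990, §2.1 (p. 11)] -/
theorem measureReal_strictFundamentalSet_unipotent_pos (hc : c * c = 1)
    (μN : Measure (unipotentInBorel F E c 3)) [μN.IsHaarMeasure]
    {Ω : Set (unipotentInBorel F E c 3)} (hΩ : MeasurableSet Ω)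
    (hΩu : ∀ n : unipotentInBorel F E c 3,
      ∃! ν : (((quasiSplit F E c 3).arithmeticSubgroup).subgroupOf (borelAdelic F E c 3)).subgroupOf
        (unipotentInBorel F E c 3), ν • n ∈ Ω) :
    0 < μN.real Ω := by
  obtain ⟨h0, ht⟩ := measure_strictFundamentalSet_unipotent_ne_zero_and_lt_top hc μN hΩ hΩu
  exact ENNReal.toReal_pos h0 ht.ne

/-! ## §2 The (C-γ) heads with `hΩfin` discharged -/

section Corollaries

variable [Algebra.IsQuadraticExtension F E]
  [MeasurableSpace (AdeleRing (𝓞 F) F)ˣ] [BorelSpace (AdeleRing (𝓞 F) F)ˣ]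
  (ζ : ratOne F E c) {z₁ : (quasiSplit F E c 3).arithmeticSubgroup}

/-- **`hCfin` with NO side condition**: ★ `lintegral_weight_mul_enorm_centrePart_lt_top_of_hasCompactSupport` with
`hΩfin` discharged by ★ `measure_strictFundamentalSet_unipotent_ne_top`.
[cite: Rogawski1990, §7.3 (7.3.2) and Prop. 7.3.2 (c), (d) (pp. 96–97)] [cite: Arthur1981TraceFormulaInvariantForm, §2] -/
theorem lintegral_weight_mul_enorm_centrePart_lt_top_cc (hc : c * c = 1) (hc1 : c ≠ 1)
    {δ : E} (hcδ : c δ = -δ) (hδ : δ ≠ 0) (θ : 𝓞 F) (hθ : θ ≠ 0) (hd : δ * δ = algebraMap F E (θ : F))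
    (hz₁ : (z₁ : (quasiSplit F E c 3).Adelic) =
      (quasiSplit F E c 3).toAdelic (ratCenter F E c 3 ((StdForm.antidiagonal 3).over E) ζ))
    (νG : Measure (quasiSplit F E c 3).Adelic) [νG.IsHaarMeasure]
    (μB : Measure (borelAdelic F E c 3)) [μB.IsHaarMeasure]
    (μK : Measure ((standardMaximalCompactGL 3 E).comap
      (adelicVal F E c 3 ((StdForm.antidiagonal 3).over E)) : Subgroup (quasiSplit F E c 3).Adelic))
    [μK.IsHaarMeasure]
    (μT : Measure (torusInBorel F E c 3)) [μT.IsHaarMeasure]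
    (μN : Measure (unipotentInBorel F E c 3)) [μN.IsHaarMeasure]
    (hBK : ∀ g : (quasiSplit F E c 3).Adelic, ∃ b ∈ borelAdelic F E c 3, ∃ k : (quasiSplit F E c 3).Adelic,
      adelicVal F E c 3 ((StdForm.antidiagonal 3).over E) k ∈ standardMaximalCompactGL 3 E ∧ g = b * k)
    {Ω : Set (unipotentInBorel F E c 3)} (hΩ : MeasurableSet Ω)
    (hΩu : ∀ n : unipotentInBorel F E c 3,
      ∃! ν : (((quasiSplit F E c 3).arithmeticSubgroup).subgroupOf (borelAdelic F E c 3)).subgroupOf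
        (unipotentInBorel F E c 3), ν • n ∈ Ω)
    {wT : torusInBorel F E c 3 → ℝ≥0∞}
    (hwT : IsCoveringWeight ((((quasiSplit F E c 3).arithmeticSubgroup).subgroupOf (borelAdelic F E c 3)).subgroupOf
      (torusInBorel F E c 3)) wT)
    (μF : Measure (AdeleRing (𝓞 F) F)ˣ) [IsHaarMeasure μF]
    {f : (quasiSplit F E c 3).Adelic → ℂ} (hfc : Continuous f) (hf : HasCompactSupport f)
    {β : (quasiSplit F E c 3).Adelic → ℝ≥0∞}
    (hβ : IsCoveringWeight ((arithmeticBorel F E c 3).map (quasiSplit F E c 3).arithmeticSubgroup.subtype) β) :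
    ∫⁻ g, β g * ‖∑' w : {w : rationalTraceZero F E c // w ≠ 0},
        f (g⁻¹ * ((z₁ : (quasiSplit F E c 3).Adelic) *
          (((heisChart hc ((0 : AdeleRing (𝓞 E) E), ((w.1 : rationalTraceZero F E c) : traceZeroAdele F E c))) :
            adelicUnipotent F E c 3) : (quasiSplit F E c 3).Adelic)) * g)‖ₑ ∂νG < ∞ :=
  lintegral_weight_mul_enorm_centrePart_lt_top_of_hasCompactSupport ζ hc hc1 hcδ hδ θ hθ hd hz₁ νG μB μK μT μN hBK hΩ hΩu
    (measure_strictFundamentalSet_unipotent_ne_top hc μN hΩ hΩu) hwT μF hfc hf hβ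

/-- **`(hCi, hCv)` with NO side condition**: ★ `exists_integrable_and_integral_weight_smul_centrePart_eq` with `hΩfin`
discharged by ★ `measure_strictFundamentalSet_unipotent_ne_top` — for every `z₁ = ι(ratCenter ζ)`, `f ∈ C_c(G(𝔸))` and
covering weight `β` of `B(F)♯`, `β • ψᶜ_f ∈ L¹(ν_G)` and
`∫ β • ψᶜ_f dν_G = C · μ_N(Ω) · ∫_{y ∈ F^*·N(I_E)} (‖y‖²)⁻¹ • Φ_f(y) dμ_F`.
[cite: Rogawski1990, §7.3 (7.3.2) and Prop. 7.3.2 (c), (d) (pp. 96–97)] [cite: Arthur1981TraceFormulaInvariantForm, §2] -/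
theorem exists_integrable_and_integral_weight_smul_centrePart_eq_cc (hc : c * c = 1) (hc1 : c ≠ 1)
    {δ : E} (hcδ : c δ = -δ) (hδ : δ ≠ 0) (θ : 𝓞 F) (hθ : θ ≠ 0) (hd : δ * δ = algebraMap F E (θ : F))
    (νG : Measure (quasiSplit F E c 3).Adelic) [νG.IsHaarMeasure]
    (μB : Measure (borelAdelic F E c 3)) [μB.IsHaarMeasure]
    (μK : Measure ((standardMaximalCompactGL 3 E).comap
      (adelicVal F E c 3 ((StdForm.antidiagonal 3).over E)) : Subgroup (quasiSplit F E c 3).Adelic))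
    [μK.IsHaarMeasure]
    (μT : Measure (torusInBorel F E c 3)) [μT.IsHaarMeasure]
    (μN : Measure (unipotentInBorel F E c 3)) [μN.IsHaarMeasure]
    (hBK : ∀ g : (quasiSplit F E c 3).Adelic, ∃ b ∈ borelAdelic F E c 3, ∃ k : (quasiSplit F E c 3).Adelic,
      adelicVal F E c 3 ((StdForm.antidiagonal 3).over E) k ∈ standardMaximalCompactGL 3 E ∧ g = b * k)
    {Ω : Set (unipotentInBorel F E c 3)} (hΩ : MeasurableSet Ω)
    (hΩu : ∀ n : unipotentInBorel F E c 3,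
      ∃! ν : (((quasiSplit F E c 3).arithmeticSubgroup).subgroupOf (borelAdelic F E c 3)).subgroupOf
        (unipotentInBorel F E c 3), ν • n ∈ Ω)
    {wT : torusInBorel F E c 3 → ℝ≥0∞}
    (hwT : IsCoveringWeight ((((quasiSplit F E c 3).arithmeticSubgroup).subgroupOf (borelAdelic F E c 3)).subgroupOf
      (torusInBorel F E c 3)) wT)
    (μF : Measure (AdeleRing (𝓞 F) F)ˣ) [IsHaarMeasure μF] :
    ∃ C : ℝ≥0, 0 < C ∧
      ∀ (ζ : ratOne F E c) {z₁ : (quasiSplit F E c 3).arithmeticSubgroup},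
        (z₁ : (quasiSplit F E c 3).Adelic) =
          (quasiSplit F E c 3).toAdelic (ratCenter F E c 3 ((StdForm.antidiagonal 3).over E) ζ) →
      ∀ {f : (quasiSplit F E c 3).Adelic → ℂ}, Continuous f → HasCompactSupport f →
      ∀ {β : (quasiSplit F E c 3).Adelic → ℝ≥0∞},
        IsCoveringWeight ((arithmeticBorel F E c 3).map (quasiSplit F E c 3).arithmeticSubgroup.subtype) β →
        Integrable (fun g : (quasiSplit F E c 3).Adelic => (β g).toReal •
          ∑' w : {w : rationalTraceZero F E c // w ≠ 0},
            f (g⁻¹ * ((z₁ : (quasiSplit F E c 3).Adelic) *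
              (((heisChart hc ((0 : AdeleRing (𝓞 E) E), ((w.1 : rationalTraceZero F E c) : traceZeroAdele F E c))) :
                adelicUnipotent F E c 3) : (quasiSplit F E c 3).Adelic)) * g)) νG ∧
        ∫ g, (β g).toReal •
          ∑' w : {w : rationalTraceZero F E c // w ≠ 0},
            f (g⁻¹ * ((z₁ : (quasiSplit F E c 3).Adelic) *
              (((heisChart hc ((0 : AdeleRing (𝓞 E) E), ((w.1 : rationalTraceZero F E c) : traceZeroAdele F E c))) :
                adelicUnipotent F E c 3) : (quasiSplit F E c 3).Adelic)) * g) ∂νG =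
          ((C : ℝ) : ℂ) * (μN.real Ω : ℂ) *
            ∫ y in ↑(GaloisRepresentations.principalIdeles F ⊔ normIdeles F (θ : F)),
              (((IdeleClassGroup.ideleNorm F y ^ 2)⁻¹ : ℝ≥0) : ℝ) •
                ∫ k, f ((k : (quasiSplit F E c 3).Adelic)⁻¹ * ((z₁ : (quasiSplit F E c 3).Adelic) *
                  ((heisChart hc ((0 : AdeleRing (𝓞 E) E),
                      traceZeroLine F E c hcδ hδ (((y⁻¹ : (AdeleRing (𝓞 F) F)ˣ)) : AdeleRing (𝓞 F) F)) :
                    adelicUnipotent F E c 3) : (quasiSplit F E c 3).Adelic)) * (k : (quasiSplit F E c 3).Adelic)) ∂μK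
              ∂μF :=
  exists_integrable_and_integral_weight_smul_centrePart_eq hc hc1 hcδ hδ θ hθ hd νG μB μK μT μN hBK hΩ hΩu
    (measure_strictFundamentalSet_unipotent_ne_top hc μN hΩ hΩu) hwT μF

end Corollaries

end UnitaryGroup

end Literature.NumberTheory.Automorphic

end
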